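import Summits.AtomisticToContinuum.FouriersLaw.Theorems.BondHeatUncertaintyExtensiveSnapshotIrreversibilityEnergyWindowSkeletonDefect
import Summits.AtomisticToContinuum.FouriersLaw.Theorems.BondHeatUncertaintyExtensiveSnapshotIrreversibilityEnergyWindowSkeletonRegularity

/-!
# Energy window, part W-0 — (I-s2)ₛ `SkeletonEventualSurjectivity` TYPED, and the vanishing of the
regularisation defect in the mean (the `m' → ∞` half of the limit order)

Lineage `stmt-AtomisticToContinuum-9121` (`ExtensiveSnapshotIrreversibility`), K_fix half, leaf S3
`KernelTemperatureLipschitz`; record (G1*ᶜᶜ) ⟸ (SWM)ₐ ∧ (JMˣ)₁ ∧ (JMˣ)₂ [+ (I-s2)ₛ; U-glue],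
(G1ℓ) ⟸ (SWM)_d ∧ (JM) ∧ (JMˣ)₁ ∧ (JMˣ)₂ [+ (I-s2)ₛ; V-glue] (critic rows 1107, 1128 (d)).  Cell
decomp-a2c, lens «grading / quantitative ladder», generation 81, part W «Glues», file 0.

§1 **(I-s2)ₛ `SkeletonEventualSurjectivity`** (support leaf, ATTACKABLE-M; the tree has the case
`s = 1`: `exists_forall_range_fderiv_skelFlowMap_eq_top`, and `skelFlowMapAt … 1 … = skelFlowMap …`
is `rfl`): for positive parameters and bath temperatures, every `s ∈ (0, 1]`, every starting point
`z` and EVERY driving path `wp`, the skeleton derivative `D_Ξ E^{s}_{m}(z, R_m wp, Ξ_m wp)` of the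
time-`s` flow map is onto phase space for all large levels `m ≥ m₀(z, wp)` — deterministic, no
measure.  It is exactly the hypothesis of part S file 4's `defect_sq_le_linear_of_range_eq_top`.
§2 Coordinates versus norms: `|coordV v a| ≤ ‖v‖`, `‖ofCoordV c‖ ≤ √(c ⬝ᵥ c)`.
§3 THE DEFECT IN THE MEAN (`tendsto_lintegral_sqrt_defect`): along the diagonal `κ_n = (n+1)⁻¹`,
level `n`, the dominator `D_n(wp) = √(κ_n · eᵀ(Γ_n(wp)+κ_n)⁻¹e)` of the regularisation defect
(`κ_n |a_{m,κ_n}| ≤ D_n` for EVERY `m ≥ n`, part S `defect_sq_le`) satisfies `E[D_n] → 0` under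
(I-s2)ₛ — dominated convergence with the level-free dominator `|e|` (`mul_dotProduct_regInv_mulVec_le`),
the pointwise limit from Loewner monotonicity in the level (`dotProduct_regInv_skelGramPath_antitone`)
and `eᵀ(Γ_{m₀}+κ)⁻¹e ≤ eᵀΓ_{m₀}⁻¹e` once `Γ_{m₀} ≻ 0` (`posDef_skelGramAt_of_range_eq_top`); the vector
`e` may depend measurably on the path (departure: `e = V(wp)`, dominator `|V| ∈ L¹` by (JM)).
The consumer form `exists_lintegral_defect_le`: `∀ η > 0 ∃ n ∀ m ≥ n`, the mean of
`κ_n ‖a_{m,κ_n}♯‖`-type defects is `≤ η` — the limit order of critic row 1077 (b) («`κ` first, `m ≥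
max(m', m₁(κ))` floats») realised along one diagonal sequence.
No instance / notation / option; no proof holes.  References: D. Nualart, The Malliavin Calculus and
Related Topics (2006), §2.3 [cite: Nualart2006, §2.3]; R. Bhatia, Positive Definite Matrices (2007),
Ch. 1 [cite: Bhatia2007, Ch. 1]. [folklore]
-/

noncomputable section

namespace Summit.AtomisticToContinuum.FouriersLaw.Theorems.ExtensiveSnapshotIrreversibility.EnergyWindow

open MeasureTheory ProbabilityTheory Filter Topology Set
open scoped ENNReal NNReal Matrix ContDiff
open Literature.MathematicalPhysics.KineticTheory.HeatConduction
open Literature.Probability.Process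

/-! ## 1. (I-s2)ₛ — eventual surjectivity of the skeleton derivative at time `s` -/

/-- **(I-s2)ₛ `SkeletonEventualSurjectivity`** — support leaf (ATTACKABLE-M), the time-`s` version of
the tree's `exists_forall_range_fderiv_skelFlowMap_eq_top` (`s = 1`): for `ω₂, lam, β, γ > 0`,
`N ≥ 1`, bath temperatures `T_L, T_R > 0`, every `0 < s ≤ 1`, every starting point `z` and EVERY
driving path `wp` there is a level `m₀` such that for all `m ≥ m₀` the skeleton derivative
`D_Ξ E^{s}_{m}(z, R_m wp, ·)(Ξ_m wp) : PairSkeleton m → PhaseSpace N` is onto.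
PLAN (port of the tree proof to `[0, s]`, est. 250–350 lines): the ranges increase with `m` (part S
`fderiv_skelFlowMapAt_refinePair`), hence stabilise (Noetherian); if the stable range missed a costate
direction `c₁ ≠ 0`, the costate `c` on `[0, s]` with `c(s) = c₁` would pair to zero with the
variational endpoints of all dyadic tent forcings supported in `[0, s]`, so the dyadic means of its
left-bath momentum component vanish on `(0, s)`, whence `c ≡ 0` there
(`eqOn_zero_of_dyadic_integral_eq_zero`, `costate_eq_zero_of_snd_left` on `J = Ioo 0 s`) and `c₁ = 0`.
USE: the `m' → ∞` half of the defect limit (§3) in both glues.  (after Nualart2006, §2.3)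
[route leaf · named hypothesis of this cell, NOT filed as a literature fact] -/
def SkeletonEventualSurjectivity : Prop :=
  ∀ ω₂ lam β γ : ℝ, 0 < ω₂ → 0 < lam → 0 < β → 0 < γ →
    ∀ N : ℕ, 0 < N → ∀ T_L T_R : ℝ, 0 < T_L → 0 < T_R →
      ∀ s : ℝ, 0 < s → s ≤ 1 → ∀ (z : PhaseSpace N) (wp : WienerPair),
        ∃ m₀ : ℕ, ∀ m : ℕ, m₀ ≤ m →
          LinearMap.range (fderiv ℝ (skelFlowMapAt ω₂ lam β γ N T_L T_R s m z (pairRem m wp))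
            (pairSkel m wp) : PairSkeleton m →ₗ[ℝ] PhaseSpace N) = ⊤

/-- At `s = 1` the leaf IS the tree theorem (sanity of the typing; the leaf asks for `0 < s ≤ 1`).
[folklore] -/
theorem skeletonEventualSurjectivity_one {ω₂ lam β γ : ℝ} (hω : 0 < ω₂) (hl : 0 ≤ lam)
    (hβ : 0 ≤ β) (hγ : 0 < γ) {N : ℕ} (hN : 0 < N) {T_L : ℝ} (hTL : 0 < T_L) (T_R : ℝ)
    (z : PhaseSpace N) (wp : WienerPair) :
    ∃ m₀ : ℕ, ∀ m : ℕ, m₀ ≤ m →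
      LinearMap.range (fderiv ℝ (skelFlowMapAt ω₂ lam β γ N T_L T_R 1 m z (pairRem m wp))
        (pairSkel m wp) : PairSkeleton m →ₗ[ℝ] PhaseSpace N) = ⊤ :=
  exists_forall_range_fderiv_skelFlowMap_eq_top hω hl hβ hγ.le N T_L T_R hγ hTL hN z wp

/-! ## 2. Coordinates versus norms on phase space -/

/-- `|coordV v a| ≤ ‖v‖` (sup norm of the product of sup-normed factors). [folklore] -/
theorem abs_coordV_apply_le_norm {N : ℕ} (v : PhaseSpace N) (a : Fin N ⊕ Fin N) :
    |coordV N v a| ≤ ‖v‖ := by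
  rcases a with i | i
  · calc |coordV N v (Sum.inl i)| = ‖v.1 i‖ := by simp [coordV, Real.norm_eq_abs]
      _ ≤ ‖v.1‖ := norm_le_pi_norm _ i
      _ ≤ ‖v‖ := norm_fst_le v
  · calc |coordV N v (Sum.inr i)| = ‖v.2 i‖ := by simp [coordV, Real.norm_eq_abs]
      _ ≤ ‖v.2‖ := norm_le_pi_norm _ i
      _ ≤ ‖v‖ := norm_snd_le v

/-- `c a ^ 2 ≤ c ⬝ᵥ c`. [folklore] -/
theorem sq_apply_le_dotProduct {ι : Type} [Fintype ι] (c : ι → ℝ) (a : ι) :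
    c a ^ 2 ≤ c ⬝ᵥ c := by
  classical
  have h : c ⬝ᵥ c = ∑ k, c k ^ 2 := by simp [dotProduct, sq]
  rw [h]
  exact Finset.single_le_sum (f := fun k => c k ^ 2) (fun k _ => sq_nonneg (c k))
    (Finset.mem_univ a)

/-- `|c a| ≤ √(c ⬝ᵥ c)`. [folklore] -/
theorem abs_apply_le_sqrt_dotProduct {ι : Type} [Fintype ι] (c : ι → ℝ) (a : ι) :
    |c a| ≤ √(c ⬝ᵥ c) := by
  rw [← Real.sqrt_sq_eq_abs]
  exact Real.sqrt_le_sqrt (sq_apply_le_dotProduct c a)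

/-- `‖ofCoordV c‖ ≤ √(c ⬝ᵥ c)` (sup norm ≤ Euclidean norm). [folklore] -/
theorem norm_ofCoordV_le_sqrt_dotProduct {N : ℕ} (c : Fin N ⊕ Fin N → ℝ) :
    ‖ofCoordV N c‖ ≤ √(c ⬝ᵥ c) := by
  have h0 : 0 ≤ √(c ⬝ᵥ c) := Real.sqrt_nonneg _
  refine (Prod.norm_def _).le.trans (max_le ?_ ?_)
  · refine (pi_norm_le_iff_of_nonneg h0).2 fun i => ?_
    rw [Real.norm_eq_abs]
    exact abs_apply_le_sqrt_dotProduct c (Sum.inl i)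
  · refine (pi_norm_le_iff_of_nonneg h0).2 fun i => ?_
    rw [Real.norm_eq_abs]
    exact abs_apply_le_sqrt_dotProduct c (Sum.inr i)

/-- `√(c ⬝ᵥ c) ≤ Σ_a |c a|` (Euclidean norm ≤ ℓ¹ norm). [folklore] -/
theorem sqrt_dotProduct_le_sum_abs {ι : Type} [Fintype ι] (c : ι → ℝ) :
    √(c ⬝ᵥ c) ≤ ∑ a, |c a| := by
  classical
  have h : c ⬝ᵥ c = ∑ k, |c k| ^ 2 := by simp [dotProduct, sq]
  rw [h, Real.sqrt_le_left (Finset.sum_nonneg fun k _ => abs_nonneg (c k))]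
  exact Finset.sum_sq_le_sq_sum_of_nonneg fun k _ => abs_nonneg (c k)

/-- `0 ≤ c ⬝ᵥ c` over `ℝ`. [folklore] -/
theorem dotProduct_self_nonneg_real {ι : Type} [Fintype ι] (c : ι → ℝ) : 0 ≤ c ⬝ᵥ c :=
  Finset.sum_nonneg fun k _ => mul_self_nonneg (c k)

/-- Measurability of `a ↦ v(a)ᵀ M(a) w(a)` from that of the entries. [folklore] -/
theorem measurable_dotProduct_mulVec {α ι : Type} [MeasurableSpace α] [Fintype ι]
    {M : α → Matrix ι ι ℝ} {v w : α → ι → ℝ} (hM : ∀ k l, Measurable fun a => M a k l)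
    (hv : ∀ k, Measurable fun a => v a k) (hw : ∀ l, Measurable fun a => w a l) :
    Measurable fun a => v a ⬝ᵥ (M a *ᵥ w a) := by
  have h1 : ∀ k, Measurable fun a => (M a *ᵥ w a) k := fun k => by
    simp only [Matrix.mulVec, dotProduct]
    exact Finset.measurable_sum _ fun l _ => (hM k l).mul (hw l)
  simp only [dotProduct]
  exact Finset.measurable_sum _ fun k _ => (hv k).mul (h1 k)

/-! ## 3. The regularisation defect vanishes in the mean under (I-s2)ₛ -/

/-- **The defect dominator along the diagonal** `D_n(wp)² = κ_n · eᵀ(Γ_n(wp)+κ_n)⁻¹e`,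
`κ_n = (n+1)⁻¹`, level `n`, for a path-dependent vector `e`. [folklore] -/
def defectSq (ω₂ lam β γ : ℝ) (N : ℕ) (T_L T_R : ℝ) (s : ℝ) (z : PhaseSpace N)
    (e : WienerPair → Fin N ⊕ Fin N → ℝ) (n : ℕ) (wp : WienerPair) : ℝ :=
  ((n : ℝ) + 1)⁻¹ * (e wp ⬝ᵥ (regInv (skelGramPath ω₂ lam β γ N T_L T_R s n z wp) ((n : ℝ) + 1)⁻¹ *ᵥ
    e wp))

section DefectMean

variable {ω₂ lam β γ : ℝ} (hω : 0 < ω₂) (hl : 0 ≤ lam) (hβ : 0 ≤ β) (hγ : 0 ≤ γ) (N : ℕ)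
  (T_L T_R : ℝ)

/-- The quadratic form `eᵀ(Γ+κ)⁻¹e` is nonnegative (`Γ ⪰ 0`, `κ > 0`; from `sq_defect_le`).
[folklore] -/
theorem dotProduct_regInv_mulVec_nonneg {ι : Type} [Fintype ι] [DecidableEq ι] {Γ : Matrix ι ι ℝ}
    (hΓ : Γ.PosSemidef) {κ : ℝ} (hκ : 0 < κ) (e : ι → ℝ) : 0 ≤ e ⬝ᵥ (regInv Γ κ *ᵥ e) := by
  have h := sq_defect_le hΓ hκ e
  have h0 : 0 ≤ κ ^ 2 * ((regInv Γ κ *ᵥ e) ⬝ᵥ (regInv Γ κ *ᵥ e)) :=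
    mul_nonneg (sq_nonneg κ) (dotProduct_self_nonneg_real _)
  nlinarith

/-- The diagonal regularisation `κ_n = (n+1)⁻¹ > 0`. [folklore] -/
theorem inv_natCast_succ_pos (n : ℕ) : (0 : ℝ) < ((n : ℝ) + 1)⁻¹ := by positivity

/-- `0 ≤ D_n²`. [folklore] -/
theorem defectSq_nonneg (s : ℝ) (z : PhaseSpace N) (e : WienerPair → Fin N ⊕ Fin N → ℝ) (n : ℕ)
    (wp : WienerPair) : 0 ≤ defectSq ω₂ lam β γ N T_L T_R s z e n wp :=
  mul_nonneg (inv_natCast_succ_pos n).le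
    (dotProduct_regInv_mulVec_nonneg (posSemidef_skelGramAt z _ _) (inv_natCast_succ_pos n) _)

/-- `D_n² ≤ |e|²` — the level-free dominator. [folklore] -/
theorem defectSq_le_dotProduct (s : ℝ) (z : PhaseSpace N) (e : WienerPair → Fin N ⊕ Fin N → ℝ)
    (n : ℕ) (wp : WienerPair) :
    defectSq ω₂ lam β γ N T_L T_R s z e n wp ≤ e wp ⬝ᵥ e wp :=
  mul_dotProduct_regInv_mulVec_le (posSemidef_skelGramAt z _ _) (inv_natCast_succ_pos n) _

include hω hl hβ hγ in
/-- ★ **Pathwise domination of the defect, uniformly in the level `m ≥ n`**: with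
`a_{m,κ_n} = (Γ_m+κ_n)⁻¹ e`, `κ_n ‖a_{m,κ_n}♯‖ ≤ κ_n |a_{m,κ_n}| ≤ D_n` (part S `defect_sq_le`,
sup norm ≤ Euclidean norm). [folklore] -/
theorem mul_norm_ofCoordV_regInv_le_sqrt_defectSq {s : ℝ} (hs : s ∈ Icc (0 : ℝ) 1)
    (z : PhaseSpace N) (e : WienerPair → Fin N ⊕ Fin N → ℝ) {n m : ℕ} (h : n ≤ m)
    (wp : WienerPair) :
    ((n : ℝ) + 1)⁻¹ * ‖ofCoordV N (regInv (skelGramPath ω₂ lam β γ N T_L T_R s m z wp)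
        ((n : ℝ) + 1)⁻¹ *ᵥ e wp)‖ ≤
      √(defectSq ω₂ lam β γ N T_L T_R s z e n wp) := by
  set κ : ℝ := ((n : ℝ) + 1)⁻¹ with hκdef
  have hκ : 0 < κ := inv_natCast_succ_pos n
  set a := regInv (skelGramPath ω₂ lam β γ N T_L T_R s m z wp) κ *ᵥ e wp with ha
  have h1 : κ * ‖ofCoordV N a‖ ≤ κ * √(a ⬝ᵥ a) :=
    mul_le_mul_of_nonneg_left (norm_ofCoordV_le_sqrt_dotProduct a) hκ.le
  have h2 : κ * √(a ⬝ᵥ a) = √(κ ^ 2 * (a ⬝ᵥ a)) := by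
    rw [Real.sqrt_mul' _ (dotProduct_self_nonneg_real a), Real.sqrt_sq hκ.le]
  have h3 : κ ^ 2 * (a ⬝ᵥ a) ≤ defectSq ω₂ lam β γ N T_L T_R
      s z e n wp := defect_sq_le hω hl hβ hγ N T_L T_R hs z wp hκ (e wp) h
  calc κ * ‖ofCoordV N a‖ ≤ √(κ ^ 2 * (a ⬝ᵥ a)) := h1.trans h2.le
    _ ≤ _ := Real.sqrt_le_sqrt h3

include hω hl hβ hγ in
/-- `D_n²` is measurable in the path when `e` is (entries of `(Γ+κ)⁻¹` jointly measurable in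
(skeleton, remainder): part T-b `measurable_regInv_skelGramAt_apply`). [folklore] -/
theorem measurable_defectSq {s : ℝ} (hs : s ∈ Icc (0 : ℝ) 1) (z : PhaseSpace N)
    {e : WienerPair → Fin N ⊕ Fin N → ℝ} (he : ∀ a, Measurable fun wp => e wp a) (n : ℕ) :
    Measurable (defectSq ω₂ lam β γ N T_L T_R s z e n) := by
  have hι : Measurable fun wp : WienerPair => (pairSkel n wp, pairRem n wp) :=
    (measurable_pairSkel n).prodMk (measurable_pairRem n)
  have hR : ∀ k l, Measurable fun wp : WienerPair =>
      regInv (skelGramPath ω₂ lam β γ N T_L T_R s n z wp) ((n : ℝ) + 1)⁻¹ k l := by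
    intro k l
    have h := (measurable_regInv_skelGramAt_apply hω hl hβ hγ N T_L T_R hs n (((n : ℝ) + 1)⁻¹)
      z k l).comp hι
    exact h
  exact measurable_const.mul (measurable_dotProduct_mulVec hR he he)

include hω hl hβ hγ in
/-- **Pointwise limit**: if the skeleton derivative along `wp` is onto for all `m ≥ m₀` then
`D_n(wp)² → 0` (for `n ≥ m₀`: `D_n² ≤ κ_n eᵀ(Γ_{m₀}+κ_n)⁻¹e ≤ κ_n eᵀΓ_{m₀}⁻¹e`). [folklore] -/
theorem tendsto_defectSq {s : ℝ} (hs : s ∈ Icc (0 : ℝ) 1) (z : PhaseSpace N)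
    (e : WienerPair → Fin N ⊕ Fin N → ℝ) (wp : WienerPair) {m₀ : ℕ}
    (hsurj : ∀ m, m₀ ≤ m → LinearMap.range
      (fderiv ℝ (skelFlowMapAt ω₂ lam β γ N T_L T_R s m z (pairRem m wp)) (pairSkel m wp) :
        PairSkeleton m →ₗ[ℝ] PhaseSpace N) = ⊤) :
    Tendsto (fun n => defectSq ω₂ lam β γ N T_L T_R s z e n wp)
      atTop (𝓝 0) := by
  have hPD : (skelGramPath ω₂ lam β γ N T_L T_R s m₀ z wp).PosDef :=
    posDef_skelGramAt_of_range_eq_top z _ _ (hsurj m₀ le_rfl)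
  set L := e wp ⬝ᵥ ((skelGramPath ω₂ lam β γ N T_L T_R s m₀ z wp)⁻¹ *ᵥ e wp) with hL
  -- the upper bound `κ_n · L → 0`
  have hκ : Tendsto (fun n : ℕ => ((n : ℝ) + 1)⁻¹) atTop (𝓝 0) :=
    tendsto_one_div_add_atTop_nhds_zero_nat.congr fun n => one_div _
  have hup : Tendsto (fun n : ℕ => ((n : ℝ) + 1)⁻¹ * L) atTop (𝓝 0) := by
    simpa using hκ.mul_const L
  refine tendsto_of_tendsto_of_tendsto_of_le_of_le' tendsto_const_nhds hup
    (Eventually.of_forall fun n => defectSq_nonneg N T_L T_R s z e n wp) ?_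
  filter_upwards [eventually_ge_atTop m₀] with n hn
  have hκn := inv_natCast_succ_pos n
  unfold defectSq
  refine mul_le_mul_of_nonneg_left ?_ hκn.le
  exact (dotProduct_regInv_skelGramPath_antitone hω hl hβ hγ N T_L T_R hs z wp hκn (e wp) hn).trans
    (dotProduct_regInv_mulVec_le_inv hPD hκn (e wp))

include hω hl hβ hγ in
/-- ★ **The defect vanishes in the mean** under eventual surjectivity along every path (the
hypothesis in the form (I-s2)ₛ delivers at time `s`) for a measurable path-dependent vector `e`
with `E|e| < ∞`: `E[D_n] → 0` (dominated convergence, dominator `|e|`). [folklore] -/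
theorem tendsto_lintegral_sqrt_defectSq {s : ℝ} (hs : s ∈ Icc (0 : ℝ) 1) (z : PhaseSpace N)
    (hsurj : ∀ wp : WienerPair, ∃ m₀ : ℕ, ∀ m, m₀ ≤ m → LinearMap.range
      (fderiv ℝ (skelFlowMapAt ω₂ lam β γ N T_L T_R s m z (pairRem m wp)) (pairSkel m wp) :
        PairSkeleton m →ₗ[ℝ] PhaseSpace N) = ⊤)
    {e : WienerPair → Fin N ⊕ Fin N → ℝ} (he : ∀ a, Measurable fun wp => e wp a)
    (heI : ∫⁻ wp, ENNReal.ofReal (√(e wp ⬝ᵥ e wp)) ∂wienerPair ≠ ⊤) :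
    Tendsto (fun n => ∫⁻ wp, ENNReal.ofReal
        (√(defectSq ω₂ lam β γ N T_L T_R s z e n wp)) ∂wienerPair)
      atTop (𝓝 0) := by
  have h0 : (0 : ℝ≥0∞) = ∫⁻ _ : WienerPair, 0 ∂wienerPair := by simp
  rw [h0]
  refine tendsto_lintegral_of_dominated_convergence
    (fun wp => ENNReal.ofReal (√(e wp ⬝ᵥ e wp))) (fun n => ?_) (fun n => ?_) heI ?_
  · exact ENNReal.measurable_ofReal.comp
      (Real.continuous_sqrt.measurable.comp (measurable_defectSq hω hl hβ hγ N T_L T_R hs z he n))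
  · exact Eventually.of_forall fun wp => ENNReal.ofReal_le_ofReal
      (Real.sqrt_le_sqrt (defectSq_le_dotProduct N T_L T_R s z e n wp))
  · refine Eventually.of_forall fun wp => ?_
    obtain ⟨m₀, hm₀⟩ := hsurj wp
    have h := tendsto_defectSq hω hl hβ hγ N T_L T_R hs z e wp hm₀
    have h' : Tendsto (fun n => √(defectSq ω₂ lam β γ N T_L T_R
        s z e n wp)) atTop (𝓝 0) := by
      have h1 := (Real.continuous_sqrt.tendsto 0).comp h
      rw [Real.sqrt_zero] at h1
      exact h1
    have h2 := (ENNReal.continuous_ofReal.tendsto 0).comp h'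
    rw [ENNReal.ofReal_zero] at h2
    exact h2

include hω hl hβ hγ in
/-- ★★ **Consumer form of the limit order** (critic row 1077 (b): `κ` FIRST — here `κ_n = (n+1)⁻¹` —
then every level `m ≥ n` floats): under eventual surjectivity along every path, for every `η > 0`
there is `n` with `E[D_n] ≤ η`, and `κ_n ‖a_{m,κ_n}♯‖ ≤ D_n` pathwise for all `m ≥ n`
(`mul_norm_ofCoordV_regInv_le_sqrt_defectSq`). [folklore] -/
theorem exists_lintegral_sqrt_defectSq_le {s : ℝ} (hs : s ∈ Icc (0 : ℝ) 1) (z : PhaseSpace N)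
    (hsurj : ∀ wp : WienerPair, ∃ m₀ : ℕ, ∀ m, m₀ ≤ m → LinearMap.range
      (fderiv ℝ (skelFlowMapAt ω₂ lam β γ N T_L T_R s m z (pairRem m wp)) (pairSkel m wp) :
        PairSkeleton m →ₗ[ℝ] PhaseSpace N) = ⊤)
    {e : WienerPair → Fin N ⊕ Fin N → ℝ} (he : ∀ a, Measurable fun wp => e wp a)
    (heI : ∫⁻ wp, ENNReal.ofReal (√(e wp ⬝ᵥ e wp)) ∂wienerPair ≠ ⊤) {η : ℝ} (hη : 0 < η) :
    ∃ n : ℕ, ∫⁻ wp, ENNReal.ofReal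
        (√(defectSq ω₂ lam β γ N T_L T_R s z e n wp)) ∂wienerPair ≤
      ENNReal.ofReal η := by
  have h := tendsto_lintegral_sqrt_defectSq hω hl hβ hγ N T_L T_R hs z hsurj he heI
  have hη' : (0 : ℝ≥0∞) < ENNReal.ofReal η := ENNReal.ofReal_pos.2 hη
  obtain ⟨n, hn⟩ := (ENNReal.tendsto_atTop_zero.1 h) (ENNReal.ofReal η) hη'
  exact ⟨n, hn n le_rfl⟩

end DefectMean

end Summit.AtomisticToContinuum.FouriersLaw.Theorems.ExtensiveSnapshotIrreversibility.EnergyWindow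

end
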